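import Literature.NumberTheory.Sieve.SmoothMajorantCRT
import HarnessLib

/-!
# Goldston–Yıldırım correlations, elementary route: the local expansion of a weighted tuple sum

Trunk T-SIEVE. Combinatorial engine for the proof of Green–Tao 2008, Proposition 9.6
(`Literature.NumberTheory.Sieve.GreenTao2008.GoldstonYildirimCorrelations`). After the Chinese
remainder theorem, the expanded correlation `E ∏_i Λ_R(θ_i)²` is a **weighted tuple sum**

  `T_P(f; φ) = ∑_{d : ι → squarefreeOf P} (∏_{p ∈ P} f_p(X_p(d))) · ∏_{v} φ_v(d_v)`,

over tuples (indexed by the slots `v ∈ ι`, in the application `ι = [m] ⊔ [m]`) of squarefree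
numbers built from a finite set of primes `P`, with a LOCAL weight `f_p` depending only on the
divisibility pattern `X_p(d) = {v : p ∣ d_v}` (the local densities `(-1)^{|X|} ω_X(p)` of Green–Tao's
(10.3)) and a SLOT weight `φ_v` (the cut-offs `log₊(R_v/d_v)`), cf. `CFZ.sum_squarefreeTuples_eq_prod`
(the case `φ ≡ 1`, where the sum is an Euler product). This file proves, by induction on `P`:

* `tupleSum_insert` — splitting off one prime:
  `T_{P ∪ {p₀}}(f; φ) = ∑_{X ⊆ ι} f_{p₀}(X) · T_P(f; φ ∘ (p₀^{[· ∈ X]} ·))`;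
* `tupleSum_eq_sum_expansion` — **the local expansion**: for two local weight systems `a` (the true
  one) and `κ` (a model) with `a_p(∅) = κ_p(∅) = 1`, writing `e_p = a_p - κ_p` (so `e_p(∅) = 0`),
  `T_P(a; φ) = ∑_{n : ι → squarefreeOf P} (∏_{p ∈ P, X_p(n) ≠ ∅} e_p(X_p(n))) · T_{P ∖ supp n}(κ; φ ∘ (n ·))`,
  `supp n = {p : X_p(n) ≠ ∅}`: the true sum is the model sum plus, for every non-empty set `S` of
  "exceptional" primes and every pattern on `S`, the product of the (small) local discrepancies
  `e_p` times the MODEL sum over the remaining primes with the levels divided by the `S`-parts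
  `n_v`. (For Green–Tao's Prop. 9.6 the model `κ_p(X) = (-1)^{|X|} p^{-|idx X|}` is the kernel of
  `m` independent copies of the one-form Goldston–Yıldırım sum, `e_p = O(p^{-2})` at primes not
  dividing `Δ = ∏ (h_i - h_j)` and `O(1/p)` at the others; this is the tree's substitute for the
  factorisation `F = G₀ G₁ G₂ G₃` of §10 of the source.)

## References
* B. Green, T. Tao, Ann. of Math. (2) 167 (2008), §10, (10.5)–(10.8), (10.11). [cite: GreenTaoAnnals2008]
-/

noncomputable section

open Finset
open scoped BigOperators

namespace Literature.NumberTheory.Sieve.GreenTao2008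

namespace GYCorr

variable {ι : Type*} [Fintype ι] [DecidableEq ι]

/-! ### Weighted tuple sums -/

/-- **The weighted tuple sum** `T_P(f; φ) = ∑_{d : ι → squarefreeOf P} (∏_{p ∈ P} f_p(X_p(d))) ∏_v φ_v(d_v)`.
[cite: GreenTaoAnnals2008, Section 10 eq. 10.2 (the shape of the expanded correlation)] -/
def tupleSum (P : Finset ℕ) (f : ℕ → Finset ι → ℝ) (φ : ι → ℕ → ℝ) : ℝ :=
  ∑ d ∈ Fintype.piFinset (fun _ : ι => CFZ.squarefreeOf P), (∏ p ∈ P, f p (CFZ.pattern d p)) * ∏ v, φ v (d v)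

/-- Unfolding `tupleSum`. [folklore] -/
theorem tupleSum_def (P : Finset ℕ) (f : ℕ → Finset ι → ℝ) (φ : ι → ℕ → ℝ) :
    tupleSum P f φ = ∑ d ∈ Fintype.piFinset (fun _ : ι => CFZ.squarefreeOf P),
      (∏ p ∈ P, f p (CFZ.pattern d p)) * ∏ v, φ v (d v) := rfl

/-- `squarefreeOf ∅ = {1}`. [folklore] -/
theorem squarefreeOf_empty : CFZ.squarefreeOf (∅ : Finset ℕ) = {1} := by
  unfold CFZ.squarefreeOf
  rw [Finset.powerset_empty, Finset.image_singleton, Finset.prod_empty]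

/-- Over the empty set of primes the tuple sum is the single all-ones tuple: `T_∅(f; φ) = ∏_v φ_v(1)`.
[folklore] -/
theorem tupleSum_empty (f : ℕ → Finset ι → ℝ) (φ : ι → ℕ → ℝ) :
    tupleSum (∅ : Finset ℕ) f φ = ∏ v, φ v 1 := by
  unfold tupleSum
  rw [squarefreeOf_empty, Fintype.piFinset_singleton]  -- piFinset of singletons = {const 1}
  simp

/-- The tuple sum only depends on the values of the slot weights at positive integers and of the
local weights at primes of `P` (congruence lemma). [folklore] -/
theorem tupleSum_congr {P : Finset ℕ} {f f' : ℕ → Finset ι → ℝ} {φ φ' : ι → ℕ → ℝ}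
    (hf : ∀ p ∈ P, ∀ X, f p X = f' p X) (hφ : ∀ v, ∀ d, d ≠ 0 → φ v d = φ' v d) (hP : ∀ p ∈ P, p.Prime) :
    tupleSum P f φ = tupleSum P f' φ' := by
  unfold tupleSum
  refine Finset.sum_congr rfl fun d hd => ?_
  rw [Finset.prod_congr rfl fun p hp => hf p hp _]
  congr 1
  refine Fintype.prod_congr _ _ fun v => hφ v _ ?_
  exact ((CFZ.mem_squarefreeOf hP).1 (Fintype.mem_piFinset.1 hd v)).1.ne_zero

/-! ### Splitting off one prime -/

/-- Membership in `squarefreeOf (insert p₀ P)`: `d = p₀^ε d'` with `d' ∈ squarefreeOf P`.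
[folklore] -/
theorem mul_mem_squarefreeOf_insert {P : Finset ℕ} {p₀ : ℕ} (hP : ∀ p ∈ P, p.Prime) (hp₀ : p₀.Prime)
    (hp₀P : p₀ ∉ P) {d : ℕ} (hd : d ∈ CFZ.squarefreeOf P) (b : Bool) :
    (if b then p₀ * d else d) ∈ CFZ.squarefreeOf (insert p₀ P) := by
  have hP' : ∀ p ∈ insert p₀ P, p.Prime := by
    intro p hp; rcases Finset.mem_insert.1 hp with rfl | hp; exacts [hp₀, hP p hp]
  obtain ⟨hsq, hsub⟩ := (CFZ.mem_squarefreeOf hP).1 hd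
  rw [CFZ.mem_squarefreeOf hP']
  cases b with
  | false => exact ⟨hsq, hsub.trans (Finset.subset_insert _ _)⟩
  | true =>
    simp only [ite_true]
    have hcop : Nat.Coprime p₀ d := by
      rw [Nat.Prime.coprime_iff_not_dvd hp₀]
      intro h
      exact hp₀P (hsub (Nat.mem_primeFactors.2 ⟨hp₀, h, hsq.ne_zero⟩))
    refine ⟨Nat.squarefree_mul_iff.2 ⟨hcop, hp₀.squarefree, hsq⟩, ?_⟩
    rw [Nat.primeFactors_mul hp₀.ne_zero hsq.ne_zero, hp₀.primeFactors]
    exact Finset.union_subset_union (Finset.Subset.refl _) hsub |>.trans (by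
      intro p hp
      rcases Finset.mem_union.1 hp with h | h
      · exact Finset.mem_insert.2 (Or.inl (Finset.mem_singleton.1 h))
      · exact Finset.mem_insert_of_mem h)

/-- Splicing the prime `p₀` into a tuple along the pattern `X`: `(splice p₀ X d)_v = p₀^{[v ∈ X]} d_v`.
[folklore] -/
def splice (p₀ : ℕ) (X : Finset ι) (d : ι → ℕ) : ι → ℕ := fun v => if v ∈ X then p₀ * d v else d v

omit [Fintype ι] in
/-- Unfolding `splice`. [folklore] -/
theorem splice_apply (p₀ : ℕ) (X : Finset ι) (d : ι → ℕ) (v : ι) :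
    splice p₀ X d v = if v ∈ X then p₀ * d v else d v := rfl

/-- Tuples over `P` are not divisible by a prime `p₀ ∉ P`. [folklore] -/
theorem not_dvd_of_mem_piFinset {P : Finset ℕ} {p₀ : ℕ} (hP : ∀ p ∈ P, p.Prime) (hp₀ : p₀.Prime)
    (hp₀P : p₀ ∉ P) {d : ι → ℕ} (hd : d ∈ Fintype.piFinset (fun _ : ι => CFZ.squarefreeOf P)) (v : ι) :
    ¬ p₀ ∣ d v := by
  intro h
  have hdv := (CFZ.mem_squarefreeOf hP).1 (Fintype.mem_piFinset.1 hd v)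
  exact hp₀P (hdv.2 (Nat.mem_primeFactors.2 ⟨hp₀, h, hdv.1.ne_zero⟩))

/-- The pattern of a spliced tuple at the new prime is the splicing pattern. [folklore] -/
theorem pattern_splice_self {p₀ : ℕ} (X : Finset ι) {d : ι → ℕ} (hnd : ∀ v, ¬ p₀ ∣ d v) :
    CFZ.pattern (splice p₀ X d) p₀ = X := by
  ext v
  simp only [CFZ.pattern, Finset.mem_filter, Finset.mem_univ, true_and, splice_apply]
  by_cases hv : v ∈ X
  · simp [hv]
  · simp [hv, hnd v]

/-- The pattern of a spliced tuple at any other prime is unchanged. [folklore] -/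
theorem pattern_splice_of_ne {p₀ p : ℕ} (hp₀ : p₀.Prime) (hp : p.Prime) (hne : p ≠ p₀) (X : Finset ι) (d : ι → ℕ) :
    CFZ.pattern (splice p₀ X d) p = CFZ.pattern d p := by
  ext v
  simp only [CFZ.pattern, Finset.mem_filter, Finset.mem_univ, true_and, splice_apply]
  by_cases hv : v ∈ X
  · rw [if_pos hv]
    constructor
    · intro h
      rcases (Nat.Prime.dvd_mul hp).1 h with h1 | h1
      · exact absurd ((Nat.prime_dvd_prime_iff_eq hp hp₀).1 h1) hne
      · exact h1
    · intro h; exact Dvd.dvd.mul_left h _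
  · rw [if_neg hv]

/-- **Tuples over `P ∪ {p₀}` are the spliced tuples over `P`** (a prime `p₀ ∉ P`): for any `G`,
`∑_{d over P ∪ {p₀}} G(d) = ∑_{X ⊆ ι} ∑_{d' over P} G(splice p₀ X d')`. [folklore] -/
theorem sum_piFinset_insert {P : Finset ℕ} {p₀ : ℕ} (hP : ∀ p ∈ P, p.Prime) (hp₀ : p₀.Prime) (hp₀P : p₀ ∉ P)
    (G : (ι → ℕ) → ℝ) :
    ∑ d ∈ Fintype.piFinset (fun _ : ι => CFZ.squarefreeOf (insert p₀ P)), G d =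
      ∑ X : Finset ι, ∑ d' ∈ Fintype.piFinset (fun _ : ι => CFZ.squarefreeOf P), G (splice p₀ X d') := by
  classical
  have hP' : ∀ p ∈ insert p₀ P, p.Prime := by
    intro p hp; rcases Finset.mem_insert.1 hp with rfl | hp; exacts [hp₀, hP p hp]
  rw [← Finset.sum_product']
  symm
  refine Finset.sum_nbij' (fun x : Finset ι × (ι → ℕ) => splice p₀ x.1 x.2)
    (fun d : ι → ℕ => (CFZ.pattern d p₀, fun v => if p₀ ∣ d v then d v / p₀ else d v)) ?_ ?_ ?_ ?_ ?_
  · -- maps to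
    rintro ⟨X, d'⟩ hx
    rw [Finset.mem_product] at hx
    refine Fintype.mem_piFinset.2 fun v => ?_
    have hdv := Fintype.mem_piFinset.1 hx.2 v
    rw [splice_apply]
    simpa using mul_mem_squarefreeOf_insert hP hp₀ hp₀P hdv (decide (v ∈ X))
  · -- maps back
    intro d hd
    rw [Finset.mem_product]
    refine ⟨Finset.mem_univ _, Fintype.mem_piFinset.2 fun v => ?_⟩
    have hdv := (CFZ.mem_squarefreeOf hP').1 (Fintype.mem_piFinset.1 hd v)
    rw [CFZ.mem_squarefreeOf hP]
    dsimp only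
    by_cases h : p₀ ∣ d v
    · rw [if_pos h]
      obtain ⟨k, hk⟩ := h
      rw [hk, Nat.mul_div_cancel_left k hp₀.pos]
      have hsq' : Squarefree (p₀ * k) := hk ▸ hdv.1
      have hsqk : Squarefree k := (Nat.squarefree_mul_iff.1 hsq').2.2
      refine ⟨hsqk, fun p hp => ?_⟩
      have hpk := Nat.dvd_of_mem_primeFactors hp
      have hpp := Nat.prime_of_mem_primeFactors hp
      have hpd : p ∈ (d v).primeFactors :=
        Nat.mem_primeFactors.2 ⟨hpp, hk ▸ Dvd.dvd.mul_left hpk p₀, hdv.1.ne_zero⟩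
      rcases Finset.mem_insert.1 (hdv.2 hpd) with rfl | hpP
      · exfalso
        exact (Nat.Prime.coprime_iff_not_dvd hp₀).1 (Nat.squarefree_mul_iff.1 hsq').1 hpk
      · exact hpP
    · rw [if_neg h]
      refine ⟨hdv.1, fun p hp => ?_⟩
      rcases Finset.mem_insert.1 (hdv.2 hp) with rfl | hpP
      · exact absurd (Nat.dvd_of_mem_primeFactors hp) h
      · exact hpP
  · -- left inverse
    rintro ⟨X, d'⟩ hx
    rw [Finset.mem_product] at hx
    have hnd : ∀ v, ¬ p₀ ∣ d' v := not_dvd_of_mem_piFinset hP hp₀ hp₀P hx.2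
    refine Prod.ext ?_ ?_
    · exact pattern_splice_self X hnd
    · funext v
      dsimp only
      rw [splice_apply]
      by_cases hv : v ∈ X
      · rw [if_pos hv, if_pos (dvd_mul_right p₀ _), Nat.mul_div_cancel_left _ hp₀.pos]
      · rw [if_neg hv, if_neg (hnd v)]
  · -- right inverse
    intro d hd
    funext v
    simp only [splice_apply, CFZ.pattern, Finset.mem_filter, Finset.mem_univ, true_and]
    by_cases h : p₀ ∣ d v
    · rw [if_pos h, if_pos h, Nat.mul_div_cancel' h]
    · rw [if_neg h, if_neg h]
  · -- summands
    rintro ⟨X, d'⟩ _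
    rfl

/-- **Splitting off one prime**: for a prime `p₀ ∉ P`,
`T_{P ∪ {p₀}}(f; φ) = ∑_{X ⊆ ι} f_{p₀}(X) · T_P(f; v ↦ d ↦ φ_v(p₀^{[v ∈ X]} d))`.
[cite: GreenTaoAnnals2008, Section 10 (Euler product structure of (10.6)–(10.7))] -/
theorem tupleSum_insert {P : Finset ℕ} {p₀ : ℕ} (hP : ∀ p ∈ P, p.Prime) (hp₀ : p₀.Prime) (hp₀P : p₀ ∉ P)
    (f : ℕ → Finset ι → ℝ) (φ : ι → ℕ → ℝ) :
    tupleSum (insert p₀ P) f φ =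
      ∑ X : Finset ι, f p₀ X * tupleSum P f (fun v d => φ v (if v ∈ X then p₀ * d else d)) := by
  unfold tupleSum
  rw [sum_piFinset_insert hP hp₀ hp₀P]
  refine Finset.sum_congr rfl fun X _ => ?_
  rw [Finset.mul_sum]
  refine Finset.sum_congr rfl fun d' hd' => ?_
  have hnd : ∀ v, ¬ p₀ ∣ d' v := not_dvd_of_mem_piFinset hP hp₀ hp₀P hd'
  rw [Finset.prod_insert hp₀P, pattern_splice_self X hnd]
  have hprod : ∏ p ∈ P, f p (CFZ.pattern (splice p₀ X d') p) = ∏ p ∈ P, f p (CFZ.pattern d' p) :=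
    Finset.prod_congr rfl fun p hp => by
      rw [pattern_splice_of_ne hp₀ (hP p hp) (fun h => hp₀P (h ▸ hp)) X d']
  rw [hprod]
  simp only [splice_apply]
  ring

/-! ### The local expansion -/

/-- The local discrepancy weights with the convention `ẽ_p(∅) = 1`:
`ẽ_p(X) = a_p(X) - κ_p(X)` for `X ≠ ∅`. [cite: GreenTaoAnnals2008, Section 10 eq. 10.8 (the O(1/p²) discrepancies)] -/
def discr (a κ : ℕ → Finset ι → ℝ) (p : ℕ) (X : Finset ι) : ℝ :=
  if X = ∅ then 1 else a p X - κ p X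

omit [Fintype ι] in
/-- `ẽ_p(∅) = 1`. [folklore] -/
theorem discr_empty (a κ : ℕ → Finset ι → ℝ) (p : ℕ) : discr a κ p ∅ = 1 := if_pos rfl

omit [Fintype ι] in
/-- `ẽ_p(X) = a_p(X) - κ_p(X)` for `X ≠ ∅`. [folklore] -/
theorem discr_of_ne (a κ : ℕ → Finset ι → ℝ) (p : ℕ) {X : Finset ι} (hX : X ≠ ∅) :
    discr a κ p X = a p X - κ p X := if_neg hX

/-- **The expansion sum**
`X_P(a, κ; φ) = ∑_{n over P} (∏_{p ∈ P} ẽ_p(X_p(n))) · T_{{p ∈ P : X_p(n) = ∅}}(κ; v ↦ d ↦ φ_v(n_v d))`.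
[cite: GreenTaoAnnals2008, Section 10 eq. 10.8 and eq. 10.11 (expansion around the model factors)] -/
def expansionSum (P : Finset ℕ) (a κ : ℕ → Finset ι → ℝ) (φ : ι → ℕ → ℝ) : ℝ :=
  ∑ n ∈ Fintype.piFinset (fun _ : ι => CFZ.squarefreeOf P),
    (∏ p ∈ P, discr a κ p (CFZ.pattern n p)) *
      tupleSum (P.filter fun p => CFZ.pattern n p = ∅) κ (fun v d => φ v (n v * d))

/-- **The local expansion of a weighted tuple sum.** For local weight systems `a, κ` normalised by
`a_p(∅) = κ_p(∅) = 1` on the primes of `P`,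
`T_P(a; φ) = ∑_{n over P} (∏_{p : X_p(n) ≠ ∅} (a_p - κ_p)(X_p(n))) · T_{{p : X_p(n) = ∅}}(κ; φ(n ·))`:
expand `∏_p a_p = ∏_p (κ_p + e_p)` (one `Finset.prod_add`, here organised as an induction on `P`
splitting off one prime at a time, `tupleSum_insert`), and resum the model part over the primes not
carrying a discrepancy. [cite: GreenTaoAnnals2008, Section 10 eqs. 10.8, 10.11] -/
theorem tupleSum_eq_expansionSum {P : Finset ℕ} (hP : ∀ p ∈ P, p.Prime) (a κ : ℕ → Finset ι → ℝ)
    (ha : ∀ p ∈ P, a p ∅ = 1) (hκ : ∀ p ∈ P, κ p ∅ = 1) (φ : ι → ℕ → ℝ) :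
    tupleSum P a φ = expansionSum P a κ φ := by
  classical
  induction P using Finset.induction_on generalizing φ with
  | empty =>
    rw [tupleSum_empty]
    unfold expansionSum
    rw [squarefreeOf_empty, Fintype.piFinset_singleton, Finset.sum_singleton, Finset.prod_empty, one_mul,
      Finset.filter_empty, tupleSum_empty]
    simp
  | insert p₀ P hp₀P ih =>
    have hp₀ : p₀.Prime := hP p₀ (Finset.mem_insert_self _ _)
    have hP0 : ∀ p ∈ P, p.Prime := fun p hp => hP p (Finset.mem_insert_of_mem hp)
    have ha0 : ∀ p ∈ P, a p ∅ = 1 := fun p hp => ha p (Finset.mem_insert_of_mem hp)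
    have hκ0 : ∀ p ∈ P, κ p ∅ = 1 := fun p hp => hκ p (Finset.mem_insert_of_mem hp)
    have ha1 : a p₀ ∅ = 1 := ha p₀ (Finset.mem_insert_self _ _)
    have hκ1 : κ p₀ ∅ = 1 := hκ p₀ (Finset.mem_insert_self _ _)
    -- left side: split off `p₀`, apply the induction hypothesis
    rw [tupleSum_insert hP0 hp₀ hp₀P]
    have hL : ∀ X : Finset ι, tupleSum P a (fun v d => φ v (if v ∈ X then p₀ * d else d)) =
        expansionSum P a κ (fun v d => φ v (if v ∈ X then p₀ * d else d)) :=
      fun X => ih hP0 ha0 hκ0 _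
    simp_rw [hL]
    -- right side: split the outer sum over tuples over `insert p₀ P`
    unfold expansionSum
    rw [sum_piFinset_insert hP0 hp₀ hp₀P]
    -- abbreviations
    set E : (ι → ℕ) → ℝ := fun n' => ∏ p ∈ P, discr a κ p (CFZ.pattern n' p) with hE
    set T : (ι → ℕ) → Finset ℕ := fun n' => P.filter fun p => CFZ.pattern n' p = ∅ with hT
    set ψ : Finset ι → (ι → ℕ) → ι → ℕ → ℝ := fun X n' v d => φ v (if v ∈ X then p₀ * (n' v * d) else n' v * d)
      with hψ
    -- the summand of the right side at a spliced tuple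
    have hterm : ∀ X : Finset ι, ∀ n' ∈ Fintype.piFinset (fun _ : ι => CFZ.squarefreeOf P),
        (∏ p ∈ insert p₀ P, discr a κ p (CFZ.pattern (splice p₀ X n') p)) *
          tupleSum ((insert p₀ P).filter fun p => CFZ.pattern (splice p₀ X n') p = ∅) κ
            (fun v d => φ v (splice p₀ X n' v * d)) =
        if X = ∅ then ∑ Y : Finset ι, κ p₀ Y * (E n' * tupleSum (T n') κ (ψ Y n'))
          else (a p₀ X - κ p₀ X) * (E n' * tupleSum (T n') κ (ψ X n')) := by
      intro X n' hn'
      have hnd : ∀ v, ¬ p₀ ∣ n' v := not_dvd_of_mem_piFinset hP0 hp₀ hp₀P hn'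
      have hpat0 := pattern_splice_self X hnd
      have hpat : ∀ p ∈ P, CFZ.pattern (splice p₀ X n') p = CFZ.pattern n' p := fun p hp =>
        pattern_splice_of_ne hp₀ (hP0 p hp) (fun h => hp₀P (h ▸ hp)) X n'
      rw [Finset.prod_insert hp₀P, hpat0,
        Finset.prod_congr rfl (fun p hp => by rw [hpat p hp] : ∀ p ∈ P,
          discr a κ p (CFZ.pattern (splice p₀ X n') p) = discr a κ p (CFZ.pattern n' p))]
      rw [Finset.filter_insert, hpat0]
      have hfilt : (P.filter fun p => CFZ.pattern (splice p₀ X n') p = ∅) = T n' := by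
        rw [hT]
        exact Finset.filter_congr fun p hp => by rw [hpat p hp]
      rw [hfilt]
      by_cases hX : X = ∅
      · subst hX
        rw [if_pos rfl, if_pos rfl, discr_empty, one_mul]
        have hT0 : p₀ ∉ T n' := fun h => hp₀P (Finset.mem_of_mem_filter _ h)
        have hTP : ∀ p ∈ T n', p.Prime := fun p hp => hP0 p (Finset.mem_of_mem_filter _ hp)
        rw [tupleSum_insert hTP hp₀ hT0, Finset.mul_sum]
        refine Finset.sum_congr rfl fun Y _ => ?_
        have hcongr : tupleSum (T n') κ (fun v d => φ v (splice p₀ ∅ n' v * if v ∈ Y then p₀ * d else d)) =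
            tupleSum (T n') κ (ψ Y n') := by
          refine tupleSum_congr (fun _ _ _ => rfl) (fun v d _ => ?_) hTP
          rw [hψ, splice_apply]
          simp only [Finset.notMem_empty, if_false]
          by_cases hv : v ∈ Y
          · rw [if_pos hv, if_pos hv, Nat.mul_left_comm]
          · rw [if_neg hv, if_neg hv]
        rw [hcongr]
        ring
      · rw [if_neg hX, if_neg hX, discr_of_ne _ _ _ hX]
        have hcongr : tupleSum (T n') κ (fun v d => φ v (splice p₀ X n' v * d)) = tupleSum (T n') κ (ψ X n') := by
          refine tupleSum_congr (fun _ _ _ => rfl) (fun v d _ => ?_)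
            (fun p hp => hP0 p (Finset.mem_of_mem_filter _ hp))
          rw [hψ, splice_apply]
          dsimp only
          by_cases hv : v ∈ X
          · rw [if_pos hv, if_pos hv, Nat.mul_assoc]
          · rw [if_neg hv, if_neg hv]
        rw [hcongr]
        ring
    rw [Finset.sum_congr rfl fun X _ => Finset.sum_congr rfl fun n' hn' => hterm X n' hn']
    -- the left side, in the same abbreviations
    have hleft : ∀ X : Finset ι, ∑ n ∈ Fintype.piFinset (fun _ : ι => CFZ.squarefreeOf P),
        (∏ p ∈ P, discr a κ p (CFZ.pattern n p)) *
          tupleSum (P.filter fun p => CFZ.pattern n p = ∅) κ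
            (fun v d => φ v (if v ∈ X then p₀ * (n v * d) else n v * d)) =
        ∑ n' ∈ Fintype.piFinset (fun _ : ι => CFZ.squarefreeOf P), E n' * tupleSum (T n') κ (ψ X n') :=
      fun X => rfl
    rw [Finset.sum_congr rfl fun X _ => by rw [hleft X]]
    -- regroup: `∑_X (if X = ∅ then ∑_Y κ Y B Y else (a X - κ X) B X) = ∑_X a X B X`
    have eL : ∑ X : Finset ι, a p₀ X * ∑ n' ∈ Fintype.piFinset (fun _ : ι => CFZ.squarefreeOf P),
        E n' * tupleSum (T n') κ (ψ X n') =
        ∑ n' ∈ Fintype.piFinset (fun _ : ι => CFZ.squarefreeOf P), ∑ X : Finset ι,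
          a p₀ X * (E n' * tupleSum (T n') κ (ψ X n')) := by
      rw [Finset.sum_comm]
      exact Finset.sum_congr rfl fun X _ => Finset.mul_sum _ _ _
    have eR : ∑ X : Finset ι, ∑ n' ∈ Fintype.piFinset (fun _ : ι => CFZ.squarefreeOf P),
        (if X = ∅ then ∑ Y : Finset ι, κ p₀ Y * (E n' * tupleSum (T n') κ (ψ Y n'))
          else (a p₀ X - κ p₀ X) * (E n' * tupleSum (T n') κ (ψ X n'))) =
        ∑ n' ∈ Fintype.piFinset (fun _ : ι => CFZ.squarefreeOf P), ∑ X : Finset ι,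
          (if X = ∅ then ∑ Y : Finset ι, κ p₀ Y * (E n' * tupleSum (T n') κ (ψ Y n'))
            else (a p₀ X - κ p₀ X) * (E n' * tupleSum (T n') κ (ψ X n'))) := Finset.sum_comm
    rw [eL, eR]
    refine Finset.sum_congr rfl fun n' _ => ?_
    have hsplit : ∀ X : Finset ι,
        (if X = ∅ then ∑ Y : Finset ι, κ p₀ Y * (E n' * tupleSum (T n') κ (ψ Y n'))
          else (a p₀ X - κ p₀ X) * (E n' * tupleSum (T n') κ (ψ X n'))) =
        (if X = ∅ then ∑ Y : Finset ι, κ p₀ Y * (E n' * tupleSum (T n') κ (ψ Y n')) else 0) +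
          (a p₀ X - κ p₀ X) * (E n' * tupleSum (T n') κ (ψ X n')) := by
      intro X
      by_cases hX : X = ∅
      · subst hX; rw [if_pos rfl, if_pos rfl, ha1, hκ1]; ring
      · rw [if_neg hX, if_neg hX]; ring
    rw [Finset.sum_congr rfl fun X _ => hsplit X, Finset.sum_add_distrib,
      Finset.sum_ite_eq' Finset.univ (∅ : Finset ι), if_pos (Finset.mem_univ _), ← Finset.sum_add_distrib]
    refine (Finset.sum_congr rfl fun X _ => ?_).symm
    ring

end GYCorr

end Literature.NumberTheory.Sieve.GreenTao2008
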